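import Summits.ValiantsHypothesis.ValiantsHypothesis.Theorems.FeketeSOSHard.Negative.TameOperatorFalse

/-!
# `FeketeSOS.FeketeSOSHard` (stmt-ValiantsHypothesis-3996) — negative side: same-support operator tameness `T_γ` fails for
# EVERY exponent `γ < log₂ √5`

Companion to `…Negative/TameOperatorFalse.lean` (seat val-width-3996-p5, g3), in the vocabulary of the trade-off composition
`…PaleyRIPTradeoff.lean` (p582034: `B_κ ∧ T_γ ⇒ FeketeSOSHard` for `κ > (γ−1)/2`).  There `T_γ` (with constant `K`) is the hypothesis
"every family of `r` weighted squares supported in `S ⊆ [0,p)` with cyclic pattern of modulus `≤ M` is re-represented by squares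
supported in the SAME `S` with the same cyclic pattern and mass `≤ K·r^K·#S^γ·M`".  `tameOperator_gamma_false`: this is FALSE for
every `γ < log₂ √5 = 1.1609…` and every `K` — the rank-2 cube family (`rankTwo_cube_mass_floor`: `#S = 2^J`, `M = 1`, floor `√5^J`)
beats `K·2^K·(2^J)^γ` as soon as `(√5/2^γ)^J > K·2^K`.  Consequently any same-support trade-off line needs `γ ≥ log₂√5`, i.e.
flat-RIP with `κ > (log₂√5 − 1)/2 = 0.0804…` (the engine's region is `κ + δ₁/2 ≤ 1/4`, `…PaleyRIPNormFloor`).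
Elementary; no facts, no definitions. [folklore]  Honest framing: negative calibration of one line's operator stub; the crux, the
engine and `VP ≠ VNP` are untouched; the inflated stub `T̃` is not hit (`…Negative/TameOperatorCubeInfl.lean`).
-/

-- `Summit.ValiantsHypothesis.ValiantsHypothesis.…` is the tree's namespace convention (summit = problem here).
set_option linter.dupNamespace false

namespace Summit.ValiantsHypothesis.ValiantsHypothesis.Theorems.FeketeSOSHard.Negative

open Finset Polynomial
open scoped BigOperators
open Summit.ValiantsHypothesis.ValiantsHypothesis.Theorems.FeketeSOSHardPaleyRIP

noncomputable section

/-- **`T_γ` is false for every `γ < log₂ √5` (and every constant `K`).**  The statement inside `¬ (…)` is the hypothesis `hT` of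
`feketeSOSHard_of_flatRIP_of_tameOperator_gamma` (`…PaleyRIPTradeoff.lean`) verbatim. [folklore] -/
theorem tameOperator_gamma_false (γ K : ℝ) (hγ : γ < Real.logb 2 (Real.sqrt 5)) :
    ¬ (∀ (p : ℕ) [Fact p.Prime] (r : ℕ) (S : Finset ℕ), (∀ a ∈ S, a < p) →
      ∀ (c : Fin r → ℂ) (w : Fin r → ℂ[X]), (∀ i, (w i).support ⊆ S) →
      ∀ (F : ℂ[X]) (M : ℝ), F.natDegree < p → ((X : ℂ[X]) ^ p - 1 ∣ (∑ i, C (c i) * w i ^ 2) - F) →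
        (∀ n, ‖F.coeff n‖ ≤ M) →
        ∃ (s' : ℕ) (c' : Fin s' → ℂ) (w' : Fin s' → ℂ[X]), (∀ j, (w' j).support ⊆ S) ∧
          ((X : ℂ[X]) ^ p - 1 ∣ (∑ j, C (c' j) * w' j ^ 2) - F) ∧
          (∑ j, sqMass (c' j) (w' j)) ≤ K * (r : ℝ) ^ K * (S.card : ℝ) ^ γ * M) := by
  intro hT
  have h5pos : 0 < Real.sqrt 5 := Real.sqrt_pos.2 (by norm_num)
  have h2γ : (2 : ℝ) ^ γ < Real.sqrt 5 := (Real.lt_logb_iff_rpow_lt one_lt_two h5pos).1 hγ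
  have h2γpos : 0 < (2 : ℝ) ^ γ := Real.rpow_pos_of_pos two_pos γ
  set ρ : ℝ := Real.sqrt 5 / (2 : ℝ) ^ γ with hρ
  have h1ρ : 1 < ρ := by rw [hρ, lt_div_iff₀ h2γpos, one_mul]; exact h2γ
  obtain ⟨J, hJ⟩ := pow_unbounded_of_one_lt (K * (2 : ℝ) ^ K) h1ρ
  obtain ⟨S, c, w, F, hcard, hlt, hwS, hrep, hdeg, hcoef, hfloor⟩ := rankTwo_cube_mass_floor J
  obtain ⟨p, hpJ, hprime⟩ := Nat.exists_infinite_primes (3 ^ J)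
  haveI : Fact p.Prime := ⟨hprime⟩
  have hSp : ∀ a ∈ S, a < p := fun a ha => by have := hlt a ha; omega
  obtain ⟨s', c', w', hsupp, hdvd, hmass⟩ := hT p 2 S hSp c w hwS F 1 (hdeg.trans_le hpJ)
    (by rw [hrep, sub_self]; exact dvd_zero _) hcoef
  -- no wrap-around: the cyclic identity is exact
  have hdegS : (∑ j, C (c' j) * w' j ^ 2).natDegree < 3 ^ J := by
    have hN : 0 < 3 ^ J := pow_pos (by norm_num) _
    have hle : (∑ j, C (c' j) * w' j ^ 2).natDegree ≤ 3 ^ J - 1 := by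
      refine natDegree_sum_le_of_forall_le _ _ fun j _ => ?_
      refine (natDegree_C_mul_le _ _).trans (natDegree_pow_le.trans ?_)
      by_cases h0 : w' j = 0
      · rw [h0, natDegree_zero, mul_zero]; exact Nat.zero_le _
      · have := hlt _ (hsupp j (natDegree_mem_support_of_nonzero h0))
        omega
    omega
  have heq : (∑ j, C (c' j) * w' j ^ 2) = F := by
    refine sub_eq_zero.1 (eq_zero_of_dvd_of_natDegree_lt hdvd ?_)
    rw [← C_1, natDegree_X_pow_sub_C]
    exact lt_of_le_of_lt (natDegree_sub_le _ _) (max_lt (hdegS.trans_le hpJ) (hdeg.trans_le hpJ))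
  have hlow := hfloor s' c' w' hsupp heq
  -- `(2^J)^γ = (2^γ)^J` and `ρ^J · (2^γ)^J = √5^J`
  have hpow : (S.card : ℝ) ^ γ = ((2 : ℝ) ^ γ) ^ J := by
    rw [hcard, Nat.cast_pow, Nat.cast_ofNat, ← Real.rpow_natCast (2 : ℝ) J, ← Real.rpow_mul (by norm_num : (0 : ℝ) ≤ 2),
      mul_comm, Real.rpow_mul (by norm_num : (0 : ℝ) ≤ 2), Real.rpow_natCast]
  have hprod : ρ ^ J * ((2 : ℝ) ^ γ) ^ J = Real.sqrt 5 ^ J := by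
    rw [← mul_pow, hρ, div_mul_cancel₀ _ h2γpos.ne']
  rw [hpow, Nat.cast_ofNat, mul_one] at hmass
  have hpos : (0 : ℝ) < ((2 : ℝ) ^ γ) ^ J := pow_pos h2γpos J
  have hlt' : K * (2 : ℝ) ^ K * ((2 : ℝ) ^ γ) ^ J < Real.sqrt 5 ^ J := by
    rw [← hprod]; exact mul_lt_mul_of_pos_right hJ hpos
  linarith

/-- Numerical form of the threshold: `log₂ √5 > 1.16`, i.e. `T_γ` fails for every `γ ≤ 1.16` and every `K`
(`(2^{1.16})^{50} = 2^{58} < 5^{25} = √5^{50}`). [folklore] -/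
theorem tameOperator_gamma_false_of_le (γ K : ℝ) (hγ : γ ≤ 1.16) :
    ¬ (∀ (p : ℕ) [Fact p.Prime] (r : ℕ) (S : Finset ℕ), (∀ a ∈ S, a < p) →
      ∀ (c : Fin r → ℂ) (w : Fin r → ℂ[X]), (∀ i, (w i).support ⊆ S) →
      ∀ (F : ℂ[X]) (M : ℝ), F.natDegree < p → ((X : ℂ[X]) ^ p - 1 ∣ (∑ i, C (c i) * w i ^ 2) - F) →
        (∀ n, ‖F.coeff n‖ ≤ M) →
        ∃ (s' : ℕ) (c' : Fin s' → ℂ) (w' : Fin s' → ℂ[X]), (∀ j, (w' j).support ⊆ S) ∧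
          ((X : ℂ[X]) ^ p - 1 ∣ (∑ j, C (c' j) * w' j ^ 2) - F) ∧
          (∑ j, sqMass (c' j) (w' j)) ≤ K * (r : ℝ) ^ K * (S.card : ℝ) ^ γ * M) := by
  refine tameOperator_gamma_false γ K (lt_of_le_of_lt hγ ?_)
  have h5pos : 0 < Real.sqrt 5 := Real.sqrt_pos.2 (by norm_num)
  rw [Real.lt_logb_iff_rpow_lt one_lt_two h5pos]
  -- `2^{1.16} < √5` ⟸ `(2^{1.16})^{50} = 2^{58} < 5^{25} = (√5)^{50}`
  have key : ((2 : ℝ) ^ (1.16 : ℝ)) ^ (50 : ℕ) < (Real.sqrt 5) ^ (50 : ℕ) := by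
    have e1 : ((2 : ℝ) ^ (1.16 : ℝ)) ^ (50 : ℕ) = (2 : ℝ) ^ (58 : ℕ) := by
      rw [← Real.rpow_natCast, ← Real.rpow_mul (by norm_num : (0 : ℝ) ≤ 2)]
      rw [show (1.16 : ℝ) * ((50 : ℕ) : ℝ) = ((58 : ℕ) : ℝ) by norm_num, Real.rpow_natCast]
    have e2 : (Real.sqrt 5) ^ (50 : ℕ) = (5 : ℝ) ^ (25 : ℕ) := by
      rw [show (50 : ℕ) = 2 * 25 from rfl, pow_mul, Real.sq_sqrt (by norm_num : (0 : ℝ) ≤ 5)]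
    rw [e1, e2]; norm_num
  exact lt_of_pow_lt_pow_left₀ 50 h5pos.le key

end

end Summit.ValiantsHypothesis.ValiantsHypothesis.Theorems.FeketeSOSHard.Negative
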